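import Summits.HodgeConjecture.HodgeConjecture.Theorems.Ring2AbelianAllAndreWeightRoots
import Literature.AlgebraicGeometry.HodgeTheory.FibrewiseEndomorphismMiddleLerayCurveBase
import Literature.AlgebraicGeometry.HodgeTheory.RestrictionImageOfCompactification
import Literature.AlgebraicGeometry.Motives.ComplexPointsEhresmann
import HarnessLib

/-!
# Ring 2 · sub-cell AbelianAll (ALL ABELIAN VARIETIES), André axis, part XXV-d — THE SPECTRAL CLAUSE (roots) FROM A FIBREWISE
# MULTIPLICATION: the Leray weights off the fibre are a THEOREM for an `S`-endomorphism charted by `[N]` on every fibre,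
# granted only the weight of the classes supported on fibres

HONEST FRAMING (page 1, verbatim): **research route, not a corollary; conditional on HC_CM plus one named
minimal statement.** Cell line: research route conditional on HC_CM; not a corollary; Q11.4-sentence-2
already refuted in dim ≥ 3. Nothing in this file proves a case of the Hodge conjecture for an abelian variety; `HC_CM`
(`RankFourFaces.CMAbelianHodge`) is a HYPOTHESIS of the two `HC_AV` rows, load-bearing as typed; item `Theses.RankFourFaces.CMToAbelian`
(stmt-16267) OPEN and not closed here. Seat `pub-hodge-ring2-ab-andre-2`, gen 17; brief (iii) "attack `B_min`: what is known".

## What this file proves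

Part XXV-a (`Ring2AbelianAllAndreWeightRoots`) reduced the Leray weight package `CMWeights[]` of part XXIV to `CMThetaRoots[]`: a
fibrewise multiplication `θ` (an endomorphism `ν` of `𝒳` restricting on `X_t` to `[N]` through a chart) and ONE spectral clause
(roots): on `ker j_t^* ⊂ Hᵏ(𝒳)`, `(ν^* - N^{k-1})(ν^* - N^{k-2}) = 0`. HERE (roots) IS PROVED for every `S`-ENDOMORPHISM `ν`
(`ν ≫ f = f`) CHARTED BY `[N]` ON EVERY FIBRE, granted one clause on classes SUPPORTED ON FIBRES:

* (gysT) for every proper Zariski-closed `T ⊊ S`, `ν^*` acts as `N^{k-2}` on the classes of `Hᵏ(𝒳)` dying off `f⁻¹T` — in print: such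
  classes are sums of Gysin images `j_{s*} x`, `s ∈ T` (Deligne, Hodge III Cor. 8.2.8 / Thom–Gysin), and `θ_N^* j_{s*} = j_{s*} θ_N^* =
  N^{k-2} j_{s*}` on `H^{k-2}(X_s)` (base change for the cartesian square `X_s ⊂ 𝒳` under `θ_N`).

**`roots_of_fibrewise_nsmul`**: (θ at every point) ∧ (gysT) ⟹ (roots) at every `t`, in every degree. PROOF (the factor `N^{k-1}` is
the theorem; the factor `N^{k-2}` is the hypothesis): `w ∈ ker j_t^*` vanishes on EVERY fibre (André's flatness, `map_fiberι_eq_zero_of_eq_zero`);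
take an AFFINE open `V ⊂ S` missing `t` (an affine neighbourhood of the generic point inside `S ∖ {t}`); the base change `𝒳_V ⟶ V` is a
smooth projective family over a smooth affine curve carrying the base change `ν_V` of `ν`, again charted by `[N]` on every fibre; by
`FibrewiseEndomorphismMiddleLerayCurveBase` (Mayer–Vietoris over the `1`-skeleta of the Andreotti–Frankel exhaustion of `V(ℂ)`, Kronecker
duality) `ν_V^*` acts as `N^{k-1}` on the pull-back of `w`; so `u := ν^* w - N^{k-1} w` dies on `𝒳_V(ℂ) = (𝒳 ∖ f⁻¹(S ∖ V))(ℂ)`, and (gysT)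
gives `ν^* u = N^{k-2} u`.

Node level (display-only brackets, F-ab-103): **`CMThetaGysin[]`** — at every CM point `t` of every compact abelian pencil there are a
locally quasi-finite `S`-endomorphism `ν`, `N ≥ 2`, charts by `[N]` on EVERY fibre, and (gysT). Both clauses are print theorems of the
ALGEBRAIC GEOMETRY of abelian schemes (Mumford GIT Thm. 6.14 + rigidity: `θ_N`; base change + purity) — NO Leray spectral sequence is left
in the hypotheses. **`cmThetaRoots_of_cmThetaGysin : CMThetaGysin[] → CMThetaRoots[]`**, hence `cmWeights_of_cmThetaGysin`, and the
rows of part XXIV from `CMThetaGysin[]`: `HC_AV_of_HC_CM_of_cmTopWeightHodge_of_thetaGysin (h₂₁) (hΘ) (hCM) (h)` and its exactness twin.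

## Honest status

No node is born (brackets display-only); nothing is minimal; nothing here is fact-free progress on `HC_AV`. Of the weight package of
part XXIV, (wt) (part XXV-a) and now the `N^{k-1}`-half of (roots) — the statement about the MIDDLE Leray piece `H¹(S, R^{k-1} f_*)`, the one
piece of the package invisible on a single fibre — are tree theorems for a fibrewise multiplication; what remains displayed is (θ at every
point: the abelian-scheme structure of a compact pencil) and (gysT) (weights of fibre-supported classes). `HC_CM` is a load-bearing binder
of the two `HC_AV` rows only.

References: Kleiman1968AlgebraicCycles (p. 374); Milne2020HodgeClassesAV (proof of Prop. 1, pp. 7–8); DeningerMurre1991 (Thm. 3.1); MumfordGIT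
(Thm. 6.14); DeligneHodgeIII1974 (Cor. 8.2.8); VoisinHodgeII2003 (§1.2.2 Thm. 1.22, §4.2.3, §4.3.1); Andre1996Motifs (§5.1, §6.3).
-/

noncomputable section

set_option linter.dupNamespace false

namespace Summit.HodgeConjecture.HodgeConjecture.Ring2.AbelianAll

open CategoryTheory CategoryTheory.Limits AlgebraicGeometry
open Literature.AlgebraicGeometry Literature.AlgebraicGeometry.Motives
open Literature.AlgebraicGeometry.HodgeTheory
open Literature.AlgebraicGeometry.Deligne1982 (cmLocus)
open Literature.AlgebraicGeometry.Andre1996 (andre1996_cmAnchoredPencil)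
open Literature.AlgebraicTopology.SingularHomology (singularCohomology)
open Summit.HodgeConjecture.HodgeConjecture
open Summit.HodgeConjecture.HodgeConjecture.Theses
open Summit.HodgeConjecture.HodgeConjecture.Ring2.Deform (HC_CM_of_HC_AV)

/-! ## §1 An affine open of the base curve missing a given point -/

section AffineOpen

variable {𝒳 S : SchemeOver ℂ} {d : ℕ} {f : 𝒳 ⟶ S}

/-- **On the smooth projective base curve of a compact pencil every complex point `t` is missed by a NON-EMPTY AFFINE open `V`**
(an affine neighbourhood of the generic point inside the open `S ∖ {t}`; the point of `t` is closed and is not the generic point of the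
curve). [cite: Hartshorne1977, II Ex. 3.20 and II Prop. 2.3] -/
theorem exists_isAffineOpen_not_mem (hf : IsCompactAbelianPencil f d) (t : ComplexPoints S) :
    ∃ V : S.left.Opens, IsAffineOpen V ∧ t.pt ∉ V ∧ (V : Set S.left).Nonempty := by
  haveI : IsIntegral S.left := IsSmoothProjective.isIntegral_holds hf.isSmoothProjective_base
  haveI : SmoothOfRelativeDimension 1 S.hom := hf.isSmoothProjective_base.smoothOfRelativeDimension
  have hne : genericPoint S.left ≠ t.pt := fun h ↦ AlgPoints.apply_ne_genericPoint t (IsLocalRing.closedPoint ℂ) h.symm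
  let U : S.left.Opens := ⟨({t.pt} : Set S.left)ᶜ, (ComplexPoints.isClosed_pt t).isOpen_compl⟩
  have hmem : genericPoint S.left ∈ U := fun h ↦ hne (Set.mem_singleton_iff.1 h)
  obtain ⟨V, hV, hgV, hVU⟩ := exists_isAffineOpen_mem_and_subset hmem
  exact ⟨V, hV, fun ht ↦ (hVU ht : t.pt ∈ U) rfl, ⟨_, hgV⟩⟩

end AffineOpen

/-! ## §2 The base change of an `S`-endomorphism to the family over an open of the base -/

section BaseChange

variable {𝒳 S S' : SchemeOver ℂ} (f : 𝒳 ⟶ S) (g : S' ⟶ S) (ν : 𝒳 ⟶ 𝒳) (hν : ν ≫ f = f)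

/-- **Base change of an `S`-endomorphism**: for `ν ≫ f = f` and `g : S' ⟶ S` there is an `S'`-endomorphism `ν'` of `𝒳 ×_S S'` with
`ν' ≫ pr₁ = pr₁ ≫ ν` (`ν' = (pr₁ ≫ ν, pr₂)`). [cite: Hartshorne1977, II §3 (base extension) and Thm. 3.3] -/
theorem exists_familyPullback_endo (hν : ν ≫ f = f) :
    ∃ ν' : familyPullback f g ⟶ familyPullback f g,
      ν' ≫ familyPullback.snd f g = familyPullback.snd f g ∧ ν' ≫ familyPullback.fst f g = familyPullback.fst f g ≫ ν := by
  have hcond : (pullback.fst f.left g.left ≫ ν.left) ≫ f.left = pullback.snd f.left g.left ≫ g.left := by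
    rw [Category.assoc, ← Over.comp_left, hν, pullback.condition]
  refine ⟨Over.homMk (pullback.lift (pullback.fst f.left g.left ≫ ν.left) (pullback.snd f.left g.left) hcond) ?_, ?_, ?_⟩
  · change pullback.lift _ _ hcond ≫ pullback.fst f.left g.left ≫ 𝒳.hom = pullback.fst f.left g.left ≫ 𝒳.hom
    rw [pullback.lift_fst_assoc, Category.assoc, Over.w ν]
  · ext : 1
    change pullback.lift _ _ hcond ≫ pullback.snd f.left g.left = pullback.snd f.left g.left
    rw [pullback.lift_snd]
  · ext : 1
    change pullback.lift _ _ hcond ≫ pullback.fst f.left g.left = pullback.fst f.left g.left ≫ ν.left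
    rw [pullback.lift_fst]

/-- **The fibres of the base change inherit the charts by `[N]`**: if `ν` restricts on the fibre of `f` over `g(s')` to an endomorphism
charted by `N · 𝟙_A`, then any base change `ν'` of `ν` (`ν' ≫ pr₁ = pr₁ ≫ ν`, `ν' ≫ pr₂ = pr₂`) restricts on the fibre of `pr₂` over `s'`
to an endomorphism acting as `Nᵏ` on `Hᵏ` (the fibres correspond by `fiberOverFamilyPullbackIso`; the fibre inclusions are monomorphisms).
[cite: Hartshorne1977, II §3 Thm. 3.3] [cite: MumfordAV1970, §19] -/
theorem exists_fiberEndo_familyPullback_eq_smul [IsSeparated S.hom] (ν' : familyPullback f g ⟶ familyPullback f g)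
    (hν's : ν' ≫ familyPullback.snd f g = familyPullback.snd f g) (hν'f : ν' ≫ familyPullback.fst f g = familyPullback.fst f g ≫ ν)
    (N : ℕ) (s' : ComplexPoints S')
    (hθ : ∃ (νs : fiberOver f (AlgPoints.map g s') ⟶ fiberOver f (AlgPoints.map g s')) (A : AbelianVariety ℂ)
      (e : A.X ≅ fiberOver f (AlgPoints.map g s')),
      νs ≫ fiberι f (AlgPoints.map g s') = fiberι f (AlgPoints.map g s') ≫ ν ∧ e.hom ≫ νs = (N • 𝟙 A).hom.hom.hom ≫ e.hom) (k : ℕ) :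
    ∃ νu : fiberOver (familyPullback.snd f g) s' ⟶ fiberOver (familyPullback.snd f g) s',
      νu ≫ fiberι (familyPullback.snd f g) s' = fiberι (familyPullback.snd f g) s' ≫ ν' ∧
        ∀ x : complexBetti (fiberOver (familyPullback.snd f g) s') k, complexBetti.map νu k x = ((N : ℂ) ^ k) • x := by
  obtain ⟨νs, A, e, hνs, he⟩ := hθ
  obtain ⟨νu, hνu⟩ := exists_fiberEndo_of_comp_eq (familyPullback.snd f g) ν' hν's s'
  refine ⟨νu, hνu, fun x ↦ ?_⟩
  set m : A.X ⟶ A.X := (N • 𝟙 A).hom.hom.hom with hm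
  set I := fiberOverFamilyPullbackIso f g s' with hI
  have hIι : I.hom ≫ fiberι f (AlgPoints.map g s') = fiberι (familyPullback.snd f g) s' ≫ familyPullback.fst f g :=
    fiberOverFamilyPullbackIso_hom_fiberι f g s'
  -- the fibre inclusion is a monomorphism (a closed immersion)
  haveI : Mono (fiberι f (AlgPoints.map g s')) := by
    haveI := Motives.isClosedImmersion_fiberι_left f (AlgPoints.map g s')
    exact (Over.forget _).mono_of_mono_map (inferInstanceAs (Mono (fiberι f (AlgPoints.map g s')).left))
  -- the chart `e ≫ I⁻¹` of the fibre of the base change identifies `νu` with `[N]`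
  have h1 : νu ≫ I.hom ≫ fiberι f (AlgPoints.map g s') = I.hom ≫ νs ≫ fiberι f (AlgPoints.map g s') := by
    calc νu ≫ I.hom ≫ fiberι f (AlgPoints.map g s')
        = νu ≫ fiberι (familyPullback.snd f g) s' ≫ familyPullback.fst f g := by rw [hIι]
      _ = fiberι (familyPullback.snd f g) s' ≫ ν' ≫ familyPullback.fst f g := by rw [← Category.assoc, hνu, Category.assoc]
      _ = fiberι (familyPullback.snd f g) s' ≫ familyPullback.fst f g ≫ ν := by rw [hν'f]
      _ = I.hom ≫ fiberι f (AlgPoints.map g s') ≫ ν := by rw [← Category.assoc, ← hIι, Category.assoc]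
      _ = I.hom ≫ νs ≫ fiberι f (AlgPoints.map g s') := by rw [hνs]
  have hchart : (e ≪≫ I.symm).hom ≫ νu = m ≫ (e ≪≫ I.symm).hom := by
    have key : ((e ≪≫ I.symm).hom ≫ νu) ≫ (I.hom ≫ fiberι f (AlgPoints.map g s')) =
        (m ≫ (e ≪≫ I.symm).hom) ≫ (I.hom ≫ fiberι f (AlgPoints.map g s')) := by
      simp only [Iso.trans_hom, Iso.symm_hom, Category.assoc]
      rw [h1, Iso.inv_hom_id_assoc, Iso.inv_hom_id_assoc, ← Category.assoc e.hom νs, he, Category.assoc]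
    haveI : Mono (I.hom ≫ fiberι f (AlgPoints.map g s')) := mono_comp _ _
    exact (cancel_mono (I.hom ≫ fiberι f (AlgPoints.map g s'))).1 key
  exact map_fiberEndo_eq_smul_of_chart s' νu A (e ≪≫ I.symm) N hchart k x

end BaseChange

/-! ## §3 (roots) from a fibrewise multiplication, granted the weight of fibre-supported classes -/

section Roots

variable {𝒳 S : SchemeOver ℂ} {d : ℕ} {f : 𝒳 ⟶ S}

/-- **THE SPECTRAL CLAUSE (roots) FOR A FIBREWISE MULTIPLICATION.** Let `f : 𝒳 ⟶ S` be a compact pencil of abelian `d`-folds, `t` a point,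
`ν : 𝒳 ⟶ 𝒳` an `S`-endomorphism (`ν ≫ f = f`) charted by `N · 𝟙_A` on EVERY fibre, and assume (gysT): for every proper Zariski-closed `T ⊊ S`,
`ν^*` acts as `N^{k-2}` on the classes of `Hᵏ(𝒳)` dying off `f⁻¹T` (print: sums of Gysin images of the fibres over `T`, of `θ_N`-weight `k-2`).
THEN (roots) holds at `t` in every degree: for `w ∈ ker j_t^*`, `ν^*ν^* w - (N^{k-1} + N^{k-2}) ν^* w + N^{k-1}N^{k-2} w = 0`. The factor `N^{k-1}`
is PROVED: `w` dies on every fibre, the base change of `(f, ν)` to a non-empty affine open `V ∌ t` is a smooth projective family over a smooth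
affine curve with an endomorphism charted by `[N]` on every fibre, on which `ν_V^*(w|) = N^{k-1}·w|` by the curve-base theorem
`map_eq_smul_of_forall_map_fiberι_eq_zero_of_affineCurveBase` (Mayer–Vietoris over `1`-skeleta); so `ν^* w - N^{k-1} w` dies off `f⁻¹(S ∖ V)`
and (gysT) applies. [cite: Milne2020HodgeClassesAV, proof of Prop. 1 (p. 7)] [cite: Kleiman1968AlgebraicCycles, p. 374]
[cite: VoisinHodgeII2003, §4.2.3 Thm. 4.15 and §1.2.2 Thm. 1.22] [cite: DeligneHodgeIII1974, Cor. 8.2.8] -/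
theorem roots_of_fibrewise_nsmul (hf : IsCompactAbelianPencil f d) (t : ComplexPoints S) (ν : 𝒳 ⟶ 𝒳) (hν : ν ≫ f = f) (N : ℕ)
    (hθ : ∀ s : ComplexPoints S, ∃ (νs : fiberOver f s ⟶ fiberOver f s) (A : AbelianVariety ℂ) (e : A.X ≅ fiberOver f s),
      νs ≫ fiberι f s = fiberι f s ≫ ν ∧ e.hom ≫ νs = (N • 𝟙 A).hom.hom.hom ≫ e.hom)
    (hgys : ∀ (T : Set S.left), IsClosed T → T ≠ Set.univ → ∀ (k : ℕ) (u : complexBetti 𝒳 k),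
      complexBetti.restrictCompl 𝒳 (f.left.base ⁻¹' T) k u = 0 → complexBetti.map ν k u = ((N : ℂ) ^ (k - 2)) • u)
    (k : ℕ) (w : complexBetti 𝒳 k) (hw : complexBetti.map (fiberι f t) k w = 0) :
    complexBetti.map ν k (complexBetti.map ν k w) - ((N : ℂ) ^ (k - 1) + (N : ℂ) ^ (k - 2)) • complexBetti.map ν k w +
      ((N : ℂ) ^ (k - 1) * (N : ℂ) ^ (k - 2)) • w = 0 := by
  cases k with
  | zero =>
    rw [top_zero hf t hw, map_zero, map_zero, smul_zero, smul_zero, sub_zero, add_zero]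
  | succ k' =>
    -- `w` vanishes on every fibre
    have hws : ∀ s : ComplexPoints S, complexBetti.map (fiberι f s) (k' + 1) w = 0 := fun s ↦ map_fiberι_eq_zero_of_eq_zero hf hw s
    -- an affine open `V` missing `t`, non-empty
    obtain ⟨V, hV, htV, hgV⟩ := exists_isAffineOpen_not_mem hf t
    -- the base change to `V`
    haveI : IsSeparated S.hom := hf.isSmoothProjective_base.isProjectiveOver.isProper.toIsSeparated
    haveI : SmoothOfRelativeDimension 1 S.hom := hf.isSmoothProjective_base.smoothOfRelativeDimension
    set ι : openSubschemeOver S V ⟶ S := openSubschemeOverι S V with hι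
    haveI : IsOpenImmersion ι.left := inferInstanceAs (IsOpenImmersion V.ι)
    haveI : IsAffine (openSubschemeOver S V).left := hV
    haveI : SmoothOfRelativeDimension 1 (openSubschemeOver S V).hom := by
      have h : SmoothOfRelativeDimension (0 + 1) (V.ι ≫ S.hom) := inferInstance
      rw [Nat.zero_add] at h
      exact h
    set f' := familyPullback.snd f ι with hf'
    set pr := familyPullback.fst f ι with hpr
    have hfam' : IsSmoothProjectiveFamily f' d := hf.isSmoothProjectiveFamily.familyPullback_snd ι
    obtain ⟨ν', hν's, hν'f⟩ := exists_familyPullback_endo f ι ν hν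
    -- the curve-base theorem for the pull-back of `w`
    have hνF' := fun s' : ComplexPoints (openSubschemeOver S V) ↦
      exists_fiberEndo_familyPullback_eq_smul f ι ν ν' hν's hν'f N s' (hθ (AlgPoints.map ι s')) k'
    have hz' : ∀ s', complexBetti.map (fiberι f' s') (k' + 1) (complexBetti.map pr (k' + 1) w) = 0 := fun s' ↦ by
      rw [← CategoryTheory.comp_apply, ← complexBetti.map_comp, ← fiberOverFamilyPullbackIso_hom_fiberι, complexBetti.map_comp,
        CategoryTheory.comp_apply, hws, map_zero]
    have hV' := map_eq_smul_of_forall_map_fiberι_eq_zero_of_affineCurveBase f' hfam' ν' hν's ((N : ℂ) ^ k') hνF'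
      (complexBetti.map pr (k' + 1) w) hz'
    -- `u := ν^* w - N^{k'} w` pulls back to zero on `𝒳_V`
    set u : complexBetti 𝒳 (k' + 1) := complexBetti.map ν (k' + 1) w - ((N : ℂ) ^ k') • w with hu
    have hpu : complexBetti.map pr (k' + 1) u = 0 := by
      rw [hu, map_sub, map_smul, ← CategoryTheory.comp_apply, ← complexBetti.map_comp, ← hν'f, complexBetti.map_comp,
        CategoryTheory.comp_apply, hV', sub_self]
    -- hence dies off `f⁻¹(S ∖ V)`: the complex points of `𝒳_V` are `(𝒳 ∖ f⁻¹(S ∖ V))(ℂ)`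
    set Z : Set 𝒳.left := f.left.base ⁻¹' ((V : Set S.left)ᶜ) with hZ
    haveI : IsOpenImmersion pr.left := by
      rw [hpr, familyPullback.fst_left]
      exact MorphismProperty.pullback_fst (P := @IsOpenImmersion) _ _ inferInstance
    have hemb : Topology.IsOpenEmbedding (AlgPoints.map pr : ComplexPoints (familyPullback f ι) → ComplexPoints 𝒳) :=
      AlgPoints.isOpenEmbedding_map_holds pr
    have hVι : ∀ y : (V : Scheme), ι.left.base y ∈ (V : Set S.left) := fun y ↦ by
      have h : V.ι.base y ∈ Set.range V.ι.base := ⟨y, rfl⟩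
      rw [Scheme.Opens.range_ι] at h
      exact h
    have hrange : Set.range (AlgPoints.map pr : ComplexPoints (familyPullback f ι) → ComplexPoints 𝒳) = {P | P.pt ∉ Z} := by
      rw [AlgPoints.range_map_of_isOpenImmersion_holds pr]
      ext P
      change P.pt ∈ Set.range (pullback.fst f.left ι.left).base ↔ ¬ (f.left.base P.pt ∈ (V : Set S.left)ᶜ)
      rw [Set.mem_compl_iff, not_not]
      constructor
      · rintro ⟨x, hx⟩
        have hpt : f.left.base ((pullback.fst f.left ι.left).base x) = ι.left.base ((pullback.snd f.left ι.left).base x) :=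
          congrArg (fun φ ↦ φ.base x) (pullback.condition (f := f.left) (g := ι.left))
        rw [← hx, hpt]
        exact hVι _
      · intro hP
        have hP' : f.left.base P.pt ∈ Set.range V.ι.base := by rw [Scheme.Opens.range_ι]; exact hP
        obtain ⟨y, hy⟩ := hP'
        obtain ⟨z, hz, -⟩ := Scheme.Pullback.exists_preimage_pullback (f := f.left) (g := ι.left) P.pt y hy.symm
        exact ⟨z, hz⟩
    have hres : complexBetti.restrictCompl 𝒳 Z (k' + 1) u = 0 := by
      let φ : ComplexPoints (familyPullback f ι) ≃ₜ complexPointsCompl 𝒳 Z :=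
        hemb.isEmbedding.toHomeomorph.trans (Homeomorph.setCongr hrange)
      have hφ : ∀ x, ((φ x : complexPointsCompl 𝒳 Z) : ComplexPoints 𝒳) = AlgPoints.map pr x := fun _ ↦ rfl
      have hfac : (⟨Subtype.val, continuous_subtype_val⟩ : C(complexPointsCompl 𝒳 Z, ComplexPoints 𝒳)).comp
          (φ : C(ComplexPoints (familyPullback f ι), complexPointsCompl 𝒳 Z)) = AlgPoints.mapContinuous (L := ℂ) pr :=
        ContinuousMap.ext hφ
      have h2 : complexBetti.restrictCompl 𝒳 Z (k' + 1) ≫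
          Literature.AlgebraicTopology.SingularHomology.singularCohomology.map ℂ ℂ
            (φ : C(ComplexPoints (familyPullback f ι), complexPointsCompl 𝒳 Z)) (k' + 1) = complexBetti.map pr (k' + 1) := by
        rw [complexBetti.map, ← hfac, Literature.AlgebraicTopology.SingularHomology.singularCohomology.map_comp]
      have hinj := (Literature.AlgebraicTopology.Homotopy.SerreFlat.bijective_cohomologyMap_homeomorph ℂ φ (k' + 1)).1
      apply hinj
      rw [map_zero, ← CategoryTheory.comp_apply, h2]
      exact hpu
    -- (gysT) on the proper closed set `S ∖ V`
    have hT : ((V : Set S.left)ᶜ) ≠ Set.univ := fun h ↦ by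
      obtain ⟨y, hy⟩ := hgV
      have : y ∈ ((V : Set S.left)ᶜ) := h ▸ Set.mem_univ _
      exact this hy
    have hgu := hgys ((V : Set S.left)ᶜ) V.isOpen.isClosed_compl hT (k' + 1) u hres
    -- the algebra: `(ν^* - N^{k-1})(ν^* - N^{k-2}) w = 0`
    have e₁ : k' + 1 - 1 = k' := by omega
    rw [e₁]
    rw [hu, map_sub, map_smul] at hgu
    calc complexBetti.map ν (k' + 1) (complexBetti.map ν (k' + 1) w) -
          ((N : ℂ) ^ k' + (N : ℂ) ^ (k' + 1 - 2)) • complexBetti.map ν (k' + 1) w + ((N : ℂ) ^ k' * (N : ℂ) ^ (k' + 1 - 2)) • w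
        = (complexBetti.map ν (k' + 1) (complexBetti.map ν (k' + 1) w) - ((N : ℂ) ^ k') • complexBetti.map ν (k' + 1) w) -
            ((N : ℂ) ^ (k' + 1 - 2)) • (complexBetti.map ν (k' + 1) w - ((N : ℂ) ^ k') • w) := by module
      _ = 0 := by rw [hgu, sub_self]

end Roots

/-! ## §4 Node level (display-only brackets): `CMThetaGysin[] ⟹ CMThetaRoots[] ⟹ CMWeights[]` and the rows -/

section Nodes

/-- DISPLAY-ONLY bracket (no `def`; REFEREE-AB F-ab-103): `CMWeights[]` of part XXIV-c, restated verbatim. -/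
local notation3 (prettyPrint := false) "CMWeights[]" =>
  ∀ ⦃d : ℕ⦄ ⦃𝒳 S : SchemeOver ℂ⦄ (f : 𝒳 ⟶ S), IsCompactAbelianPencil f d → ∀ t ∈ cmLocus f d,
    ∃ (ν : 𝒳 ⟶ 𝒳) (_ : LocallyQuasiFinite ν.left) (N : ℕ), 2 ≤ N ∧
      (∀ (k : ℕ) (w : complexBetti 𝒳 k), complexBetti.map (fiberι f t) k (complexBetti.map ν k w) =
        ((N : ℂ) ^ k) • complexBetti.map (fiberι f t) k w) ∧
      (∀ (k k₁ k₂ : ℕ), k₁ + 1 = k → k₂ + 1 = k₁ → ∀ w : complexBetti 𝒳 k, ∃ w₀ w₁ w₂ : complexBetti 𝒳 k,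
        w = w₀ + w₁ + w₂ ∧ complexBetti.map ν k w₀ = ((N : ℂ) ^ k) • w₀ ∧ complexBetti.map ν k w₁ = ((N : ℂ) ^ k₁) • w₁ ∧
        complexBetti.map ν k w₂ = ((N : ℂ) ^ k₂) • w₂) ∧
      (∀ (k : ℕ) (G : complexBetti 𝒳 k), complexBetti.map ν k G = ((N : ℂ) ^ k) • G →
        complexBetti.map (fiberι f t) k G = 0 → G = 0)

/-- DISPLAY-ONLY bracket (no `def`; REFEREE-AB F-ab-103): `CMThetaRoots[]` of part XXV-a, restated verbatim. -/
local notation3 (prettyPrint := false) "CMThetaRoots[]" =>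
  ∀ ⦃d : ℕ⦄ ⦃𝒳 S : SchemeOver ℂ⦄ (f : 𝒳 ⟶ S), IsCompactAbelianPencil f d → ∀ t ∈ cmLocus f d,
    ∃ (ν : 𝒳 ⟶ 𝒳) (_ : LocallyQuasiFinite ν.left) (N : ℕ), 2 ≤ N ∧
      (∃ (νt : fiberOver f t ⟶ fiberOver f t) (A : AbelianVariety ℂ) (e : A.X ≅ fiberOver f t),
        νt ≫ fiberι f t = fiberι f t ≫ ν ∧ e.hom ≫ νt = (N • 𝟙 A).hom.hom.hom ≫ e.hom) ∧
      (∀ (k : ℕ) (w : complexBetti 𝒳 k), complexBetti.map (fiberι f t) k w = 0 →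
        complexBetti.map ν k (complexBetti.map ν k w) - ((N : ℂ) ^ (k - 1) + (N : ℂ) ^ (k - 2)) • complexBetti.map ν k w +
          ((N : ℂ) ^ (k - 1) * (N : ℂ) ^ (k - 2)) • w = 0)

/-- DISPLAY-ONLY bracket (no `def`; REFEREE-AB F-ab-103): `CMTopWeightHodge[]` of part XXIV-d, restated verbatim. OPEN; a HYPOTHESIS. -/
local notation3 (prettyPrint := false) "CMTopWeightHodge[]" =>
  ∀ ⦃d : ℕ⦄ ⦃𝒳 S : SchemeOver ℂ⦄ (f : 𝒳 ⟶ S), IsCompactAbelianPencil f d → ∀ t ∈ cmLocus f d,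
    ∀ (ν : 𝒳 ⟶ 𝒳) (_ : LocallyQuasiFinite ν.left) (N : ℕ), 2 ≤ N →
      (∀ (k : ℕ) (w : complexBetti 𝒳 k), complexBetti.map (fiberι f t) k (complexBetti.map ν k w) =
        ((N : ℂ) ^ k) • complexBetti.map (fiberι f t) k w) →
      (∀ (k k₁ k₂ : ℕ), k₁ + 1 = k → k₂ + 1 = k₁ → ∀ w : complexBetti 𝒳 k, ∃ w₀ w₁ w₂ : complexBetti 𝒳 k,
        w = w₀ + w₁ + w₂ ∧ complexBetti.map ν k w₀ = ((N : ℂ) ^ k) • w₀ ∧ complexBetti.map ν k w₁ = ((N : ℂ) ^ k₁) • w₁ ∧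
        complexBetti.map ν k w₂ = ((N : ℂ) ^ k₂) • w₂) →
      (∀ (k : ℕ) (G : complexBetti 𝒳 k), complexBetti.map ν k G = ((N : ℂ) ^ k) • G →
        complexBetti.map (fiberι f t) k G = 0 → G = 0) →
      ∀ (p : ℕ) (y₀ : complexBetti 𝒳 (2 * (p + 1))),
        complexBetti.map ν (2 * (p + 1)) y₀ = ((N : ℂ) ^ (2 * (p + 1))) • y₀ → IsRationalClass y₀ →
        IsOfHodgeType (d + 1) 𝒳 (2 * (p + 1)) (p + 1) (p + 1) y₀ → y₀ ∈ algebraicClasses 𝒳 (p + 1)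

/-- DISPLAY-ONLY bracket (no `def`, not a census node — REFEREE-AB F-ab-103): **`CMThetaGysin[]`** — at every CM point `t` of every compact
pencil of abelian varieties there are a locally quasi-finite `S`-ENDOMORPHISM `ν` (`ν ≫ f = f`) and `N ≥ 2` such that (θ∀) `ν` restricts
on EVERY fibre `X_s` to an endomorphism charted by `N · 𝟙_A` (print: the multiplication `θ_N` of the abelian scheme — a compact pencil IS an
abelian scheme, Mumford GIT Thm. 6.14 with rigidity), and (gysT) for every proper Zariski-closed `T ⊊ S`, `ν^*` acts as `N^{k-2}` on the classes
of `Hᵏ(𝒳)` dying off `f⁻¹T` (print: Gysin images of the fibres over `T`, Deligne Hodge III Cor. 8.2.8, on which `θ_N^*` acts as `N^{k-2}` by base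
change). PRINT THEOREMS of the algebraic geometry of abelian schemes that the tree does not yet prove; displayed as a hypothesis; NO clause
about the Leray spectral sequence remains. -/
local notation3 (prettyPrint := false) "CMThetaGysin[]" =>
  ∀ ⦃d : ℕ⦄ ⦃𝒳 S : SchemeOver ℂ⦄ (f : 𝒳 ⟶ S), IsCompactAbelianPencil f d → ∀ t ∈ cmLocus f d,
    ∃ (ν : 𝒳 ⟶ 𝒳) (_ : LocallyQuasiFinite ν.left) (N : ℕ), 2 ≤ N ∧ ν ≫ f = f ∧
      (∀ s : ComplexPoints S, ∃ (νs : fiberOver f s ⟶ fiberOver f s) (A : AbelianVariety ℂ) (e : A.X ≅ fiberOver f s),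
        νs ≫ fiberι f s = fiberι f s ≫ ν ∧ e.hom ≫ νs = (N • 𝟙 A).hom.hom.hom ≫ e.hom) ∧
      (∀ (T : Set S.left), IsClosed T → T ≠ Set.univ → ∀ (k : ℕ) (u : complexBetti 𝒳 k),
        complexBetti.restrictCompl 𝒳 (f.left.base ⁻¹' T) k u = 0 → complexBetti.map ν k u = ((N : ℂ) ^ (k - 2)) • u)

/-- **`CMThetaGysin[] ⟹ CMThetaRoots[]`** (§3 at the CM point `t`; the chart at `t` is the instance `s = t` of (θ∀)).
[cite: Milne2020HodgeClassesAV, proof of Prop. 1 (p. 7)] [cite: MumfordGIT, Thm. 6.14] [cite: DeligneHodgeIII1974, Cor. 8.2.8] -/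
theorem cmThetaRoots_of_cmThetaGysin (hΘ : CMThetaGysin[]) : CMThetaRoots[] := by
  intro d 𝒳 S f hf t ht
  obtain ⟨ν, hν, N, hN, hνf, hθ, hgys⟩ := hΘ f hf t ht
  exact ⟨ν, hν, N, hN, hθ t, fun k w hw ↦ roots_of_fibrewise_nsmul hf t ν hνf N hθ hgys k w hw⟩

/-- **`CMThetaGysin[] ⟹ CMWeights[]`**: the Leray weight package of part XXIV from the algebraic geometry of the abelian scheme alone
(parts XXV-a and XXV-d). [cite: Milne2020HodgeClassesAV, proof of Prop. 1 (p. 7)] [cite: Kleiman1968AlgebraicCycles, p. 374]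
[cite: DeningerMurre1991, Thm. 3.1] [cite: MumfordGIT, Thm. 6.14] -/
theorem cmWeights_of_cmThetaGysin (hΘ : CMThetaGysin[]) : CMWeights[] :=
  cmWeights_of_cmThetaRoots (cmThetaRoots_of_cmThetaGysin hΘ)

/-- **`HC_CM ∧ [CM top-weight Hodge classes algebraic] ⟹ HC_AV`, granted [h₂₁] and `CMThetaGysin[]`** (binders in this order; `HC_CM` =
`RankFourFaces.CMAbelianHodge` a HYPOTHESIS, load-bearing): part XXIV-d's deliverable row with its weight bracket replaced by the geometric one.
research route, not a corollary; conditional on HC_CM plus one named minimal statement. [cite: Andre1996Motifs, Lemme 6.3.1 (p. 31) and Remarque 2 (p. 33)]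
[cite: Milne2020HodgeClassesAV, proof of Prop. 1 (pp. 7–8)] -/
theorem HC_AV_of_HC_CM_of_cmTopWeightHodge_of_thetaGysin (h₂₁ : andre1996_cmAnchoredPencil) (hΘ : CMThetaGysin[])
    (hCM : RankFourFaces.CMAbelianHodge) (h : CMTopWeightHodge[]) : PadicSemiregularLift.HodgeAbelianVarieties :=
  HC_AV_of_HC_CM_of_cmTopWeightHodge h₂₁ (cmWeights_of_cmThetaGysin hΘ) hCM h

/-- **EXACTNESS: `HC_AV ⟺ HC_CM ∧ [CM top-weight Hodge classes algebraic]`, granted [h₂₁], Verdier and `CMThetaGysin[]`.**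
[cite: Andre1996Motifs, Lemme 6.3.1 (p. 31) and Remarque 2 (p. 33)] [cite: Verdier1976, Cor. 5.1] [cite: Milne2020HodgeClassesAV, proof of Prop. 1 (pp. 7–8)] -/
theorem HC_AV_iff_HC_CM_and_cmTopWeightHodge_of_verdier_of_thetaGysin (h₂₁ : andre1996_cmAnchoredPencil)
    (hGT : Verdier1976_genericLocalTriviality) (hΘ : CMThetaGysin[]) :
    PadicSemiregularLift.HodgeAbelianVarieties ↔ (RankFourFaces.CMAbelianHodge ∧ CMTopWeightHodge[]) :=
  HC_AV_iff_HC_CM_and_cmTopWeightHodge_of_verdier h₂₁ hGT (cmWeights_of_cmThetaGysin hΘ)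

end Nodes

end Summit.HodgeConjecture.HodgeConjecture.Ring2.AbelianAll

end
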